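import Mathlib.NumberTheory.Padics.RingHoms
import Mathlib.RingTheory.PowerSeries.Basic
import Mathlib.Algebra.Module.MinimalAxioms
import Mathlib.Algebra.BigOperators.NatAntidiagonal
import Mathlib.Algebra.BigOperators.Intervals
import Mathlib.Topology.Algebra.OpenSubgroup
import Mathlib.Topology.LocallyConstant.Basic
import Mathlib.Analysis.Normed.Group.Ultra
import Literature.NumberTheory.GaloisRepresentations.ContinuousRep
import Literature.NumberTheory.EllipticCurves.ZpExtension
import Literature.NumberTheory.EllipticCurves.IwasawaDualModule
import HarnessLib

/-!
# The anticyclotomic "big" Galois representation `M = T ⊗_𝒪 Λ_𝒪^*(Ψ⁻¹)` as a discrete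
# `𝒪⟦T⟧`-linear continuous representation (co-induced model)

Topic `Literature/NumberTheory/EllipticCurves`; definition item `defn-AnticyclotomicBigGaloisRep`
(cell `bsd-stepL`, planner g27, for crux `stmt-BirchSwinnertonDyer-19270`; objects D1+D2 of the
prover's `SPEC-19270-RoadFF`). DEFINITIONS WITH BODIES and proved lemmas only: no named fact,
no `sorry`, no notation; the only instances are the algebraic / topological structure of the new
type `BigRepModule`.

## The printed object

* Castella, Camb. J. Math. 6 (2018) §2.1 (author PDF p. 4): "Let `Γ = Gal(K_∞/K)` be the Galois
  group of the anticyclotomic `ℤ_p`-extension of `K`, and let `Λ = ℤ_p[[Γ]]` be the anticyclotomic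
  Iwasawa algebra. Consider the `Λ`-module `𝒜 := T ⊗_{ℤ_p} Λ^*`, where `Λ^* = Hom_cont(Λ, ℚ_p/ℤ_p)` is
  the Pontryagin dual of `Λ`. Letting `ρ_{E,p}` denote the natural action of `G_K` on `T`, the
  `G_K`-action on `𝒜` is given by `ρ_{E,p} ⊗ Ψ⁻¹`, where `Ψ` is the composite character
  `G_K ↠ Γ ↪ Λ^×`." and §2.2: "we identify the one-variable power series ring `ℤ_p[[T]]` with the
  Iwasawa algebra `Λ = ℤ_p[[Γ]]` by sending `1 + T ↦ γ`".
* Castella, Erratum §2 (p. 2): "put `Λ_𝒪 = 𝒪[[Γ]]` and `M_g := T_g ⊗_𝒪 Λ_𝒪^*`, where `G_K` acts on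
  `Λ_𝒪^*` via `Ψ⁻¹`."
* Skinner, Pacific J. Math. 283 (2016) §2.3 (p. 179): "`Λ_𝒪^* = Hom_cts(Λ_𝒪, ℚ_p/ℤ_p)` … This is a
  discrete `Λ_𝒪`-module via `r·φ(x) = φ(rx)` … Put `𝓜 = T_f ⊗_𝒪 Λ_𝒪^*`, with `G_ℚ`-action given by
  `ρ_f ⊗ Ψ⁻¹`."
* Skinner–Urban, Invent. Math. 195 (2014) Prop. 3.2.3 and its proof (pp. 21–22): by Shapiro's
  lemma `lim→_n Hom_ℤ(ℤ[Gal(F_n/F)], A^*) = … = Λ^*_{F,A}(ε_F⁻¹)` and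
  `H¹(F_∞, T ⊗_A A^*) = H¹(F, T ⊗_A Λ^*_{F,A}(ε_F⁻¹))` — "This recovers [Gr94, Prop. 3.2]".

## The model typed here (co-induced / "smooth functions on `Γ`")

For a topological group `G` with a continuous homomorphism `κ : G →ₜ* ℤ_p` (the tree's
`ZpExtension K p` for `G = Γ_K`: `Gal(K_∞/K) ≅ ℤ_p` through `κ`) and a DISCRETE `𝒪`-module `A`
with a continuous `𝒪`-linear `G`-action `ρ` (`A = T ⊗_𝒪 Frac(𝒪)/𝒪 = V/T`: `E[p^∞] ⊗_{ℤ_p} 𝒪`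
for an elliptic curve, `A_g = V_g/T_g` for a newform), the module `T ⊗_𝒪 Λ_𝒪^*` is, through
`Λ_𝒪^* = lim→_n Maps(Γ/Γ^{pⁿ}, Frac(𝒪)/𝒪)` (the displayed line of [SkinnerUrban2014, Prop. 3.2.3]),
the `𝒪`-module of SMOOTH `p`-PRIMARY FUNCTIONS `Φ : ℤ_p → A` (constant on the cosets of some
`pⁿℤ_p`, values killed by some `p^k`; for `p`-primary `A` these are all the locally constant
functions `Γ → A`), with
* `G` acting by `(g · Φ)(x) = ρ(g)(Φ(x - κ g))` (`= ρ ⊗ Ψ⁻¹`: `Ψ(g) = [γ^{κ g}]` acts on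
  `Λ^* = C^∞(Γ, ·)` by `(Ψ(g)φ)(x) = φ(x + κ g)`, so `Ψ(g)⁻¹` by `x - κ g`), and
* `Λ_𝒪 = 𝒪⟦T⟧` (`PowerSeries 𝒪`) acting through the locally nilpotent endomorphism
  `ψ = τ₁ - 1`, `(T · Φ)(x) = Φ(x + 1) - Φ(x)` ("`1 + T ↦ γ`", for the topological generator
  normalised as in the tree, `ZpExtension.IsTopGenerator κ γ : κ γ = 1`), by the finite sums
  `f • Φ = ∑_{i<N} coeff_i(f) · ψ^i Φ` (`ψ^N Φ = 0`) — the direct analogue of the tree's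
  `IwasawaDual.IsLocNil.module` (dual side) with honest `𝒪`-scalars.
The two actions commute, so `g ↦ (Φ ↦ g · Φ)` is a `PowerSeries 𝒪`-linear representation; it is
JOINTLY CONTINUOUS for the discrete topology on `M` because the stabiliser of `Φ` contains the open
set `κ⁻¹(pⁿℤ_p) ∩ ⋂_{r<pⁿ} Stab_ρ(Φ(r))` (`bigRepAux_isOpen_stabilizer`). This is exactly a
`ContinuousRep Γ₀ (PowerSeries 𝒪) M` with `[DiscreteTopology M]`,
`[ContinuousSMul (PowerSeries 𝒪) M]`, the shape consumed (as `M_f`, `M_{g_m}`) by the kernel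
transfer `Summit.….X11b.TorsionControl.powerSeries_charIdeal_le_span_of_selmer_congruences`; the
local maps `ψ_v : Γ_v →ₜ* Γ₀` and the strict set `L₀` of `TorsionControl.selmer` are supplied by the
consumer (restriction to a decomposition group is `ContinuousRep.restrict`).

## Main definitions

* `LocNil.evalT`, `LocNil.IsLocNil.module` — the `PowerSeries R`-module structure on an `R`-module
  from a locally nilpotent `R`-linear endomorphism (generic algebra; `T ↦ ψ`, `C c ↦ c`).
* `bigRepSubmodule 𝒪 p A ⊆ (ℤ_[p] → A)` and the type `BigRepModule 𝒪 p A` of smooth `p`-primary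
  functions, with its `𝒪`- and `PowerSeries 𝒪`-module structures (`IsScalarTower`), the discrete
  topology, `translate`, `shiftSubOne = τ₁ - 1` (locally nilpotent: `shiftSubOne_locNil`).
* `bigRep κ ρ : ContinuousRep G (PowerSeries 𝒪) (BigRepModule 𝒪 p A)` and its unfolding
  `bigRep_apply_apply`; `BigRepModule.X_smul_apply` (`T` acts as `τ₁ - 1`), `BigRepModule.C_smul`.
* `AnticyclotomicBigGaloisRep κ ρ` — the specialisation to `G = Γ_K`, `κ : ZpExtension K p`.
* `BigRepModule.mapRange`, `mapRangeₗ`, `mapRangeEquiv`, `mapRange_bigRep` (Part 5) — functoriality in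
  `A` (post-composition), `𝒪⟦T⟧`-linear and `G`-equivariant: the transport of the erratum's
  `T_{g_m}/p^m ≃ T/p^m` (p. 4 (b)) to `M_{g_m}[p^m] ≃ M_f[p^m]` (the `θ_m` of the kernel transfer).
-- TODO(general form): (i) the `E`- and `g`-instances need `E[p^∞] ⊗ 𝒪` / `A_g` as
-- `ContinuousRep Γ_K 𝒪 A` with discrete `A` (coefficient plumbing from the tree's Weierstrass
-- layer and `GreenbergSelmer.OrdinaryNewformDatum`), not done here; (ii)
-- `ContinuousSMul (PowerSeries 𝒪) M` is provided for the discrete topology on `PowerSeries 𝒪`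
-- (`BigRepModule.instContinuousSMulOfDiscrete`); the product-topology version holds as well
-- (annihilators contain `(p^k, T^N)`) and is not needed by the consumer, which quantifies over the
-- topology of `PowerSeries 𝒪`; (iii) the identification with the tree's `K_∞`-formulation
-- `Castella2018.AcSelmer.XAc` (Shapiro, [SkinnerUrban2014, Prop. 3.2.3]) is the separate cite item F1.

References: [Castella2018] §2.1–2.2; [Castella2018Erratum] §2; [Skinner2016PacificMC] §2.3;
[SkinnerUrban2014] §3.1.1–3.1.3, Prop. 3.2.3, Rem. 3.2.4; [GreenbergLNM1716] §1 (the `Λ`-action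
through `γ - 1`, as in `IwasawaDualModule`).
-/

noncomputable section

open Finset PowerSeries

namespace Literature.NumberTheory.EllipticCurves

/-! ## Part 1. A `PowerSeries R`-module from a locally nilpotent endomorphism -/

namespace LocNil

variable {R : Type*} [CommRing R] {S : Type*} [AddCommGroup S] [Module R S] (ψ : S →ₗ[R] S)

/-- Truncated action `∑_{i<N} coeff_i(f) • ψ^i s` of `f ∈ R⟦T⟧` (the action of the image of `f` in
`R[T]/(T^N)`; independent of `N` once `ψ^N s = 0`). [folklore] -/
def evalT (N : ℕ) (f : PowerSeries R) (s : S) : S :=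
  ∑ i ∈ range N, coeff i f • (ψ ^ i) s

/-- If `ψ^N s = 0` then `ψ^{N'} s = 0` for `N ≤ N'`. [folklore] -/
private theorem pow_apply_eq_zero_of_le {N N' : ℕ} (h : N ≤ N') {s : S} (hs : (ψ ^ N) s = 0) :
    (ψ ^ N') s = 0 := by
  rw [← Nat.sub_add_cancel h, pow_add, Module.End.mul_apply, hs, map_zero]

/-- `ψ^i (ψ^j s) = ψ^{i+j} s`. [folklore] -/
private theorem pow_apply_pow_apply (i j : ℕ) (s : S) : (ψ ^ i) ((ψ ^ j) s) = (ψ ^ (i + j)) s := by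
  rw [pow_add, Module.End.mul_apply]

/-- Powers of an intertwiner: `L ∘ ψ = ψ' ∘ L` implies `L ∘ ψ^i = ψ'^i ∘ L`. [folklore] -/
private theorem map_pow_apply {S' : Type*} [AddCommGroup S'] [Module R S'] (ψ' : S' →ₗ[R] S')
    (L : S →ₗ[R] S') (hL : ∀ s, L (ψ s) = ψ' (L s)) (i : ℕ) (s : S) :
    L ((ψ ^ i) s) = (ψ' ^ i) (L s) := by
  induction i generalizing s with
  | zero => rw [pow_zero, pow_zero, Module.End.one_apply, Module.End.one_apply]
  | succ i ih => rw [pow_succ, pow_succ, Module.End.mul_apply, Module.End.mul_apply, ih, hL]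

/-- Enlarging the truncation parameter does not change `evalT` on an element killed by `ψ^N`.
[folklore] -/
private theorem evalT_of_le {N N' : ℕ} (hN : N ≤ N') (f : PowerSeries R) {s : S} (hs : (ψ ^ N) s = 0) :
    evalT ψ N' f s = evalT ψ N f s := by
  rw [evalT, evalT, ← Finset.sum_range_add_sum_Ico _ hN,
    Finset.sum_eq_zero (s := Ico N N') fun i hi ↦ by
      rw [pow_apply_eq_zero_of_le ψ (Finset.mem_Ico.mp hi).1 hs, smul_zero], add_zero]

/-- `evalT N f` is additive in `s`. [folklore] -/
private theorem evalT_add_right (N : ℕ) (f : PowerSeries R) (s t : S) :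
    evalT ψ N f (s + t) = evalT ψ N f s + evalT ψ N f t := by
  simp only [evalT, map_add, smul_add, Finset.sum_add_distrib]

/-- `evalT N f` commutes with `R`-scalars. [folklore] -/
private theorem evalT_smul_right (N : ℕ) (f : PowerSeries R) (c : R) (s : S) :
    evalT ψ N f (c • s) = c • evalT ψ N f s := by
  simp only [evalT, map_smul, Finset.smul_sum, smul_comm c]

/-- `evalT N` is additive in `f`. [folklore] -/
private theorem evalT_add_left (N : ℕ) (f g : PowerSeries R) (s : S) :
    evalT ψ N (f + g) s = evalT ψ N f s + evalT ψ N g s := by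
  simp only [evalT, map_add, add_smul, Finset.sum_add_distrib]

/-- `evalT N` is `R`-homogeneous in `f`. [folklore] -/
private theorem evalT_smul_left (N : ℕ) (c : R) (f : PowerSeries R) (s : S) :
    evalT ψ N (c • f) s = c • evalT ψ N f s := by
  simp only [evalT, map_smul, smul_eq_mul, mul_smul, Finset.smul_sum]

/-- `1` acts as the identity (for admissible `N`). [folklore] -/
private theorem evalT_one {N : ℕ} {s : S} (hsN : (ψ ^ N) s = 0) : evalT ψ N 1 s = s := by
  rw [← evalT_of_le ψ (Nat.le_succ N) 1 hsN, evalT, Finset.sum_range_succ']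
  simp only [coeff_one, Nat.succ_ne_zero, if_false, zero_smul, Finset.sum_const_zero, zero_add,
    if_true, pow_zero, Module.End.one_apply, one_smul]

/-- `T` acts as `ψ` (for admissible `N`). [folklore] -/
private theorem evalT_X {N : ℕ} {s : S} (hsN : (ψ ^ N) s = 0) : evalT ψ N PowerSeries.X s = ψ s := by
  rw [← evalT_of_le ψ (Nat.le_add_right N 2) _ hsN, evalT, Finset.sum_range_succ',
    Finset.sum_range_succ']
  simp only [coeff_X, Nat.reduceEqDiff, if_true, if_false, zero_smul, Finset.sum_const_zero,
    zero_add, add_zero, pow_one, pow_zero, Module.End.one_apply, one_smul]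

/-- Constants `c ∈ R` act as `c`. [folklore] -/
private theorem evalT_C {N : ℕ} (c : R) {s : S} (hsN : (ψ ^ N) s = 0) :
    evalT ψ N (PowerSeries.C c) s = c • s := by
  rw [← evalT_of_le ψ (Nat.le_succ N) _ hsN, evalT, Finset.sum_range_succ']
  simp only [coeff_C, Nat.succ_ne_zero, if_false, zero_smul, Finset.sum_const_zero, zero_add,
    if_true, pow_zero, Module.End.one_apply]

/-- The Cauchy product: the truncated action is multiplicative (for admissible `N`). [folklore] -/
private theorem evalT_mul {N : ℕ} (f g : PowerSeries R) {s : S} (hsN : (ψ ^ N) s = 0) :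
    evalT ψ N (f * g) s = evalT ψ N f (evalT ψ N g s) := by
  have lhs : evalT ψ N (f * g) s = ∑ m ∈ range N, ∑ ij ∈ antidiagonal m,
      coeff ij.1 f • coeff ij.2 g • (ψ ^ (ij.1 + ij.2)) s := by
    rw [evalT]
    refine Finset.sum_congr rfl fun m _ ↦ ?_
    rw [coeff_mul, Finset.sum_smul]
    refine Finset.sum_congr rfl fun ij hij ↦ ?_
    rw [mul_smul, mem_antidiagonal.mp hij]
  have rhs : evalT ψ N f (evalT ψ N g s) =
      ∑ i ∈ range N, ∑ j ∈ range N, coeff i f • coeff j g • (ψ ^ (i + j)) s := by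
    rw [evalT]
    refine Finset.sum_congr rfl fun i _ ↦ ?_
    rw [evalT, map_sum, Finset.smul_sum]
    refine Finset.sum_congr rfl fun j _ ↦ ?_
    rw [map_smul, pow_apply_pow_apply, add_comm]
  rw [lhs, rhs]
  exact IwasawaDual.sum_range_antidiagonal_eq
    (F := fun i j ↦ coeff i f • coeff j g • (ψ ^ (i + j)) s) N fun i j hij ↦ by
    simp only [pow_apply_eq_zero_of_le ψ hij hsN, smul_zero]

/-- A linear map intertwining `ψ` and `ψ'` intertwines the truncated actions. [folklore] -/
private theorem map_evalT {S' : Type*} [AddCommGroup S'] [Module R S'] (ψ' : S' →ₗ[R] S')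
    (L : S →ₗ[R] S') (hL : ∀ s, L (ψ s) = ψ' (L s)) (N : ℕ) (f : PowerSeries R) (s : S) :
    L (evalT ψ N f s) = evalT ψ' N f (L s) := by
  simp only [evalT, map_sum, map_smul, map_pow_apply ψ ψ' L hL]

/-- **Local nilpotence hypothesis**: every element of `S` is killed by a power of the endomorphism
`ψ` (which will act as `T`) — Greenberg: a discrete `Λ`-module "every element of which is killed by
`Tⁿ` for some `n`" (§1, PDF p. 60); cf. the tree's `IwasawaDual.IsLocNil` (dual side).
[cite: GreenbergLNM1716, §1 (discrete Λ-modules, after Conj. 1.3)] -/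
def IsLocNil (ψ : S →ₗ[R] S) : Prop := ∀ s : S, ∃ N : ℕ, (ψ ^ N) s = 0

namespace IsLocNil

variable {ψ} (h : IsLocNil ψ)
include h

/-- A truncation exponent for `s` (a choice). [folklore] -/
def tN (s : S) : ℕ := Classical.choose (h s)

/-- `ψ ^ h.tN s` kills `s`. [folklore] -/
private theorem tN_spec (s : S) : (ψ ^ h.tN s) s = 0 := Classical.choose_spec (h s)

/-- The action of `f ∈ R⟦T⟧`: `f • s = ∑_{i < N(s)} coeff_i(f) • ψ^i s`. [folklore] -/
def smulFun (f : PowerSeries R) (s : S) : S := evalT ψ (h.tN s) f s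

/-- **The action is through `R[T]/(T^N)` on the elements killed by `ψ^N`**:
`f • s = ∑_{i<N} coeff_i(f) • ψ^i s` for ANY `N` with `ψ^N s = 0` (Greenberg: `Λ` acts continuously
on a discrete module every element of which is killed by a power of `T`). [cite: GreenbergLNM1716, §1 (discrete Λ-modules, after Conj. 1.3)] -/
theorem smulFun_apply (f : PowerSeries R) {s : S} {N : ℕ} (hsN : (ψ ^ N) s = 0) :
    h.smulFun f s = evalT ψ N f s := by
  change evalT ψ (h.tN s) f s = _
  rw [← evalT_of_le ψ (Nat.le_add_right _ N) f (h.tN_spec s),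
    evalT_of_le ψ (Nat.le_add_left _ _) f hsN]

/-- `f •` preserves the elements killed by `ψ^N`: `ψ^N (f • s) = 0`. [folklore] -/
private theorem pow_apply_smulFun {s : S} {N : ℕ} (hsN : (ψ ^ N) s = 0) (f : PowerSeries R) :
    (ψ ^ N) (h.smulFun f s) = 0 := by
  have hcomm : ∀ t, (ψ ^ N) (ψ t) = ψ ((ψ ^ N) t) := fun t ↦ by
    rw [← Module.End.mul_apply, ← pow_succ, ← Module.End.mul_apply, ← pow_succ']
  rw [h.smulFun_apply f hsN, map_evalT ψ ψ (ψ ^ N) hcomm N f s, hsN, evalT,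
    Finset.sum_eq_zero fun i _ ↦ by rw [map_zero, smul_zero]]

/-- **The `R⟦T⟧`-module structure attached to a locally nilpotent `R`-linear `ψ`** (`T ↦ ψ`,
`C c ↦ c •`). A definition to be activated with `letI`/as an instance body (it depends on `h`).
Greenberg, LNM 1716 §1 ("every element … is killed by `Tⁿ` for some `n`. Thus … a `Λ`-module");
Lang, *Cyclotomic Fields*, Ch. 5 §1. [folklore] -/
@[reducible]
def module : Module (PowerSeries R) S :=
  letI : SMul (PowerSeries R) S := ⟨h.smulFun⟩
  Module.ofMinimalAxioms
    (fun f s t ↦ by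
      change h.smulFun f (s + t) = h.smulFun f s + h.smulFun f t
      have hst : (ψ ^ (h.tN s + h.tN t)) (s + t) = 0 := by
        rw [map_add, pow_apply_eq_zero_of_le ψ (Nat.le_add_right _ _) (h.tN_spec s),
          pow_apply_eq_zero_of_le ψ (Nat.le_add_left _ _) (h.tN_spec t), add_zero]
      rw [h.smulFun_apply f hst,
        h.smulFun_apply f (pow_apply_eq_zero_of_le ψ (Nat.le_add_right _ _) (h.tN_spec s)),
        h.smulFun_apply f (pow_apply_eq_zero_of_le ψ (Nat.le_add_left _ _) (h.tN_spec t)),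
        evalT_add_right])
    (fun f g s ↦ by
      change h.smulFun (f + g) s = h.smulFun f s + h.smulFun g s
      simp only [h.smulFun_apply _ (h.tN_spec s), evalT_add_left])
    (fun f g s ↦ by
      change h.smulFun (f * g) s = h.smulFun f (h.smulFun g s)
      rw [h.smulFun_apply _ (h.tN_spec s), h.smulFun_apply _ (h.pow_apply_smulFun (h.tN_spec s) g),
        evalT_mul ψ _ _ (h.tN_spec s), h.smulFun_apply _ (h.tN_spec s)])
    (fun s ↦ by
      change h.smulFun 1 s = s
      rw [h.smulFun_apply _ (h.tN_spec s), evalT_one ψ (h.tN_spec s)])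

/-- Under `h.module`, `f • s = h.smulFun f s` (definitional). [folklore] -/
private theorem module_smul_eq (f : PowerSeries R) (s : S) :
    (letI := h.module; f • s) = h.smulFun f s := rfl

/-- `T` acts as `ψ` (the defining property of the `Λ`-structure). [cite: GreenbergLNM1716, §1 (discrete Λ-modules, after Conj. 1.3)] -/
theorem smulFun_X (s : S) : h.smulFun PowerSeries.X s = ψ s := by
  rw [h.smulFun_apply _ (h.tN_spec s), evalT_X ψ (h.tN_spec s)]

/-- Constants `c ∈ R ⊆ R⟦T⟧` act as the given scalars: `C c • s = c • s`. [cite: GreenbergLNM1716, §1 (discrete Λ-modules, after Conj. 1.3)] -/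
theorem smulFun_C (c : R) (s : S) : h.smulFun (PowerSeries.C c) s = c • s := by
  rw [h.smulFun_apply _ (h.tN_spec s), evalT_C ψ c (h.tN_spec s)]

/-- The action commutes with `R`-scalars on `S`. [folklore] -/
private theorem smulFun_smul (f : PowerSeries R) (c : R) (s : S) :
    h.smulFun f (c • s) = c • h.smulFun f s := by
  have hcs : (ψ ^ h.tN s) (c • s) = 0 := by rw [map_smul, h.tN_spec, smul_zero]
  rw [h.smulFun_apply f hcs, h.smulFun_apply f (h.tN_spec s), evalT_smul_right]

/-- The action is `R`-homogeneous in `f`: `(c • f) • s = c • (f • s)`. [folklore] -/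
private theorem smulFun_smul_left (c : R) (f : PowerSeries R) (s : S) :
    h.smulFun (c • f) s = c • h.smulFun f s := by
  rw [h.smulFun_apply _ (h.tN_spec s), h.smulFun_apply _ (h.tN_spec s), evalT_smul_left]

/-- An `R`-linear map intertwining `ψ` and `ψ'` intertwines the two `R⟦T⟧`-actions. [folklore] -/
private theorem map_smulFun {S' : Type*} [AddCommGroup S'] [Module R S'] {ψ' : S' →ₗ[R] S'}
    (h' : IsLocNil ψ') (L : S →ₗ[R] S') (hL : ∀ s, L (ψ s) = ψ' (L s)) (f : PowerSeries R)
    (s : S) : L (h.smulFun f s) = h'.smulFun f (L s) := by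
  have hLs : (ψ' ^ h.tN s) (L s) = 0 := by
    rw [← map_pow_apply ψ ψ' L hL, h.tN_spec, map_zero]
  rw [h.smulFun_apply f (h.tN_spec s), h'.smulFun_apply f hLs, map_evalT ψ ψ' L hL]

end IsLocNil

end LocNil

/-! ## Part 2. Smooth `p`-primary functions `ℤ_p → A` -/

section Level

variable (p : ℕ) [Fact p.Prime] (A : Type*)

/-- `Φ : ℤ_p → A` is **smooth of level `n`**: constant on the cosets of `pⁿℤ_p`, i.e. a function on
`Γ/Γ^{pⁿ} = Gal(K_n/K)` (the `n`-th term `Hom_ℤ(ℤ[Gal(F_n/F)], ·)` of the direct limit computing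
`Λ^*` in [SU14]). [cite: SkinnerUrban2014, §3.1.3 and proof of Prop. 3.2.3 (Λ^* = lim Hom(ℤ[Gal(F_n/F)], ·))] -/
def IsSmoothOfLevel (n : ℕ) (Φ : ℤ_[p] → A) : Prop :=
  ∀ x y : ℤ_[p], x - y ∈ Ideal.span {(p : ℤ_[p]) ^ n} → Φ x = Φ y

variable {p A} in
/-- A function of level `n` has every level `m ≥ n`. [folklore] -/
private theorem IsSmoothOfLevel.mono {n m : ℕ} (hnm : n ≤ m) {Φ : ℤ_[p] → A} (hΦ : IsSmoothOfLevel p A n Φ) :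
    IsSmoothOfLevel p A m Φ := fun x y hxy ↦
  hΦ x y (Ideal.span_singleton_le_span_singleton.mpr (pow_dvd_pow _ hnm) hxy)

end Level

section Functions

variable (𝒪 : Type*) [CommRing 𝒪] (p : ℕ) [Fact p.Prime] (A : Type*) [AddCommGroup A] [Module 𝒪 A]

/-- **The `𝒪`-module of smooth `p`-primary functions `ℤ_p → A`** (constant on the cosets of some
`pⁿℤ_p`, with values killed by some `p^k`): the co-induced model of `T ⊗_𝒪 Λ_𝒪^*`
(`Λ_𝒪^* = lim→_n Maps(Γ/Γ^{pⁿ}, ·)`, [SkinnerUrban2014, proof of Prop. 3.2.3]).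
[cite: SkinnerUrban2014, §3.1.1 and Prop. 3.2.3 (proof)] -/
def bigRepSubmodule : Submodule 𝒪 (ℤ_[p] → A) where
  carrier := {Φ | (∃ n : ℕ, IsSmoothOfLevel p A n Φ) ∧ ∃ k : ℕ, ∀ x, p ^ k • Φ x = 0}
  zero_mem' := ⟨⟨0, fun _ _ _ ↦ rfl⟩, ⟨0, fun _ ↦ smul_zero _⟩⟩
  add_mem' := by
    rintro Φ Ψ ⟨⟨n, hn⟩, ⟨k, hk⟩⟩ ⟨⟨m, hm⟩, ⟨l, hl⟩⟩
    refine ⟨⟨n + m, fun x y hxy ↦ ?_⟩, ⟨k + l, fun x ↦ ?_⟩⟩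
    · rw [Pi.add_apply, Pi.add_apply, hn.mono (Nat.le_add_right n m) x y hxy,
        hm.mono (Nat.le_add_left m n) x y hxy]
    · rw [Pi.add_apply, smul_add, pow_add, mul_smul, mul_smul, hl, smul_zero, add_zero, smul_comm,
        hk, smul_zero]
  smul_mem' := by
    rintro c Φ ⟨⟨n, hn⟩, ⟨k, hk⟩⟩
    refine ⟨⟨n, fun x y hxy ↦ ?_⟩, ⟨k, fun x ↦ ?_⟩⟩
    · rw [Pi.smul_apply, Pi.smul_apply, hn x y hxy]
    · rw [Pi.smul_apply, smul_comm, hk, smul_zero]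

/-- The TYPE of smooth `p`-primary functions `ℤ_p → A` — the underlying `𝒪`-module of the big
representation `T ⊗_𝒪 Λ_𝒪^*(Ψ⁻¹)` in the co-induced model. The `PowerSeries 𝒪`-structure
(`T ↦ τ₁ - 1`) and the `G`-action are put on this type below.
[cite: Castella2018, §2.1 (the Λ-module 𝒜 = T ⊗ Λ^*)] -/
def BigRepModule : Type _ := ↥(bigRepSubmodule 𝒪 p A)

namespace BigRepModule

/-- The additive group structure (pointwise; inherited from the submodule). [folklore] -/
instance instAddCommGroup : AddCommGroup (BigRepModule 𝒪 p A) :=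
  inferInstanceAs (AddCommGroup ↥(bigRepSubmodule 𝒪 p A))

/-- The `𝒪`-module structure (pointwise; inherited from the submodule). [folklore] -/
instance instModule : Module 𝒪 (BigRepModule 𝒪 p A) :=
  inferInstanceAs (Module 𝒪 ↥(bigRepSubmodule 𝒪 p A))

/-- The discrete topology on `M` ("This is a discrete `Λ_𝒪`-module").
[cite: Skinner2016PacificMC, §2.3 (Λ_𝒪^* is a discrete Λ_𝒪-module; 𝓜 = T ⊗ Λ_𝒪^*)] -/
instance instTopologicalSpace : TopologicalSpace (BigRepModule 𝒪 p A) := ⊥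

/-- `M` is discrete (by definition of its topology). [cite: Skinner2016PacificMC, §2.3 (Λ_𝒪^* is a discrete Λ_𝒪-module; 𝓜 = T ⊗ Λ_𝒪^*)] -/
instance instDiscreteTopology : DiscreteTopology (BigRepModule 𝒪 p A) := ⟨rfl⟩

variable {𝒪 p A}

/-- Constructor: a smooth `p`-primary function from a function and the two witnesses. [folklore] -/
def mk (Φ : ℤ_[p] → A) (hΦ : Φ ∈ bigRepSubmodule 𝒪 p A) : BigRepModule 𝒪 p A := ⟨Φ, hΦ⟩

/-- A smooth `p`-primary function as a function. [folklore] -/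
instance instFunLike : FunLike (BigRepModule 𝒪 p A) ℤ_[p] A where
  coe Φ := (Φ : ↥(bigRepSubmodule 𝒪 p A)).1
  coe_injective _ _ h := Subtype.ext h

/-- Two smooth functions are equal iff they agree pointwise (elements of `Maps(Γ, ·)`). [cite: SkinnerUrban2014, §3.1.3 and proof of Prop. 3.2.3 (Λ^* = lim Hom(ℤ[Gal(F_n/F)], ·))] -/
@[ext] theorem ext {Φ Ψ : BigRepModule 𝒪 p A} (h : ∀ x, Φ x = Ψ x) : Φ = Ψ :=
  DFunLike.ext _ _ h

/-- Unfolding the constructor. [cite: SkinnerUrban2014, §3.1.3 and proof of Prop. 3.2.3 (Λ^* = lim Hom(ℤ[Gal(F_n/F)], ·))] -/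
@[simp] theorem mk_apply (Φ : ℤ_[p] → A) (hΦ : Φ ∈ bigRepSubmodule 𝒪 p A) (x : ℤ_[p]) :
    mk Φ hΦ x = Φ x := rfl

/-- The module operations on `Maps(Γ, A)` are pointwise: zero. [cite: SkinnerUrban2014, §3.1.3 and proof of Prop. 3.2.3 (Λ^* = lim Hom(ℤ[Gal(F_n/F)], ·))] -/
@[simp] theorem zero_apply (x : ℤ_[p]) : (0 : BigRepModule 𝒪 p A) x = 0 := rfl

/-- The module operations on `Maps(Γ, A)` are pointwise: addition. [cite: SkinnerUrban2014, §3.1.3 and proof of Prop. 3.2.3 (Λ^* = lim Hom(ℤ[Gal(F_n/F)], ·))] -/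
@[simp] theorem add_apply (Φ Ψ : BigRepModule 𝒪 p A) (x : ℤ_[p]) : (Φ + Ψ) x = Φ x + Ψ x := rfl

/-- The module operations on `Maps(Γ, A)` are pointwise: subtraction. [cite: SkinnerUrban2014, §3.1.3 and proof of Prop. 3.2.3 (Λ^* = lim Hom(ℤ[Gal(F_n/F)], ·))] -/
@[simp] theorem sub_apply (Φ Ψ : BigRepModule 𝒪 p A) (x : ℤ_[p]) : (Φ - Ψ) x = Φ x - Ψ x := rfl

/-- The module operations on `Maps(Γ, A)` are pointwise: negation. [cite: SkinnerUrban2014, §3.1.3 and proof of Prop. 3.2.3 (Λ^* = lim Hom(ℤ[Gal(F_n/F)], ·))] -/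
@[simp] theorem neg_apply (Φ : BigRepModule 𝒪 p A) (x : ℤ_[p]) : (-Φ) x = -Φ x := rfl

/-- The module operations on `Maps(Γ, A)` are pointwise: `𝒪`-scalars. [cite: SkinnerUrban2014, §3.1.3 and proof of Prop. 3.2.3 (Λ^* = lim Hom(ℤ[Gal(F_n/F)], ·))] -/
@[simp] theorem smul_apply (c : 𝒪) (Φ : BigRepModule 𝒪 p A) (x : ℤ_[p]) :
    (c • Φ) x = c • Φ x := rfl

/-- The module operations on `Maps(Γ, A)` are pointwise: integer multiples. [cite: SkinnerUrban2014, §3.1.3 and proof of Prop. 3.2.3 (Λ^* = lim Hom(ℤ[Gal(F_n/F)], ·))] -/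
theorem nsmul_apply (n : ℕ) (Φ : BigRepModule 𝒪 p A) (x : ℤ_[p]) : (n • Φ) x = n • Φ x := by
  induction n with
  | zero => rw [zero_smul, zero_smul, zero_apply]
  | succ n ih => rw [succ_nsmul, succ_nsmul, add_apply, ih]

/-- Every element lies in a finite layer `Maps(Γ/Γ^{pⁿ}, A)` of the direct limit. [cite: SkinnerUrban2014, §3.1.3 and proof of Prop. 3.2.3 (Λ^* = lim Hom(ℤ[Gal(F_n/F)], ·))] -/
theorem exists_level (Φ : BigRepModule 𝒪 p A) : ∃ n : ℕ, IsSmoothOfLevel p A n Φ :=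
  (Φ : ↥(bigRepSubmodule 𝒪 p A)).2.1

/-- Every element is killed by a power of `p` (`Λ^*`, `T ⊗ Λ^*` are `p`-primary torsion). [cite: SkinnerUrban2014, §3.1.3 and proof of Prop. 3.2.3 (Λ^* = lim Hom(ℤ[Gal(F_n/F)], ·))] -/
theorem exists_torsion (Φ : BigRepModule 𝒪 p A) : ∃ k : ℕ, ∀ x, p ^ k • Φ x = 0 :=
  (Φ : ↥(bigRepSubmodule 𝒪 p A)).2.2

/-- **Translation** `(τ_c Φ)(x) = Φ(x + c)` by `c ∈ ℤ_p` (the action of the group-like element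
`[γ^c] ∈ Λ` on `Λ^* = C^∞(Γ, ·)`), an `𝒪`-linear endomorphism. [folklore] -/
def translate (c : ℤ_[p]) : BigRepModule 𝒪 p A →ₗ[𝒪] BigRepModule 𝒪 p A where
  toFun Φ := mk (fun x ↦ Φ (x + c)) (by
    obtain ⟨n, hn⟩ := Φ.exists_level
    obtain ⟨k, hk⟩ := Φ.exists_torsion
    exact ⟨⟨n, fun x y hxy ↦ hn _ _ (by simpa using hxy)⟩, ⟨k, fun x ↦ hk _⟩⟩)
  map_add' Φ Ψ := by ext; rfl
  map_smul' c' Φ := by ext; rfl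

/-- Unfolding translation: `(τ_c Φ)(x) = Φ(x + c)` (the regular action of `γ^c ∈ Γ` on `Maps(Γ, A)`).
[cite: SkinnerUrban2014, §3.1.3 and proof of Prop. 3.2.3 (Λ^* = lim Hom(ℤ[Gal(F_n/F)], ·))] -/
@[simp] theorem translate_apply (c : ℤ_[p]) (Φ : BigRepModule 𝒪 p A) (x : ℤ_[p]) :
    translate c Φ x = Φ (x + c) := rfl

/-- `τ_0 = 1` (the regular action of `Γ` on `Maps(Γ, A)` is an action). [cite: SkinnerUrban2014, §3.1.3 and proof of Prop. 3.2.3 (Λ^* = lim Hom(ℤ[Gal(F_n/F)], ·))] -/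
theorem translate_zero : (translate 0 : BigRepModule 𝒪 p A →ₗ[𝒪] _) = LinearMap.id := by
  ext Φ x
  rw [translate_apply, add_zero, LinearMap.id_apply]

/-- `τ_{c+d} = τ_c τ_d` (the regular action of `Γ` on `Maps(Γ, A)` is an action). [cite: SkinnerUrban2014, §3.1.3 and proof of Prop. 3.2.3 (Λ^* = lim Hom(ℤ[Gal(F_n/F)], ·))] -/
theorem translate_add (c d : ℤ_[p]) :
    (translate (c + d) : BigRepModule 𝒪 p A →ₗ[𝒪] _) = translate c ∘ₗ translate d := by
  ext Φ x
  rw [LinearMap.comp_apply, translate_apply, translate_apply, translate_apply, add_assoc]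

/-- A function of level `n` (on `Γ/Γ^{pⁿ}`) is fixed by `Γ^{pⁿ} = pⁿℤ_p`. [cite: SkinnerUrban2014, §3.1.3 and proof of Prop. 3.2.3 (Λ^* = lim Hom(ℤ[Gal(F_n/F)], ·))] -/
theorem translate_eq_self_of_mem {n : ℕ} {Φ : BigRepModule 𝒪 p A} (hΦ : IsSmoothOfLevel p A n Φ)
    {c : ℤ_[p]} (hc : c ∈ Ideal.span {(p : ℤ_[p]) ^ n}) : translate c Φ = Φ := by
  ext x
  exact hΦ _ _ (by simpa using hc)

/-- **`ψ = τ₁ - 1`**, the endomorphism through which `T ∈ 𝒪⟦T⟧` acts ("`1 + T ↦ γ`").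
[cite: Castella2018, §2.2 (identification ℤ_p[[T]] = Λ, 1 + T ↦ γ)] -/
def shiftSubOne : BigRepModule 𝒪 p A →ₗ[𝒪] BigRepModule 𝒪 p A := translate 1 - LinearMap.id

/-- Unfolding `τ₁ - 1`: `((γ - 1)Φ)(x) = Φ(x + 1) - Φ(x)`. [cite: Castella2018, §2.2 (ℤ_p[[T]] = Λ via 1 + T ↦ γ)] -/
@[simp] theorem shiftSubOne_apply (Φ : BigRepModule 𝒪 p A) (x : ℤ_[p]) :
    shiftSubOne Φ x = Φ (x + 1) - Φ x := rfl

/-- Powers of an additive endomorphism that agrees with a linear map agree with its powers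
(bridge to `IwasawaDual.pow_mul_prime_pow_apply_eq_zero`, stated for `AddMonoid.End`). [folklore] -/
private theorem addMonoidEnd_pow_apply_eq (φ : AddMonoid.End (BigRepModule 𝒪 p A))
    (L : BigRepModule 𝒪 p A →ₗ[𝒪] BigRepModule 𝒪 p A) (hφ : ∀ Φ, φ Φ = L Φ) (m : ℕ)
    (Φ : BigRepModule 𝒪 p A) : (φ ^ m) Φ = (L ^ m) Φ := by
  induction m generalizing Φ with
  | zero => rw [pow_zero, pow_zero, AddMonoid.End.coe_one, id_eq, Module.End.one_apply]
  | succ m ih =>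
    rw [pow_succ, pow_succ, AddMonoid.End.coe_mul, Function.comp_apply, Module.End.mul_apply, hφ,
      ih]

/-- Powers of `τ₁` are translations: `τ₁^m = τ_m`. [folklore] -/
private theorem translate_one_pow (m : ℕ) :
    ((translate 1 : BigRepModule 𝒪 p A →ₗ[𝒪] _) ^ m) = translate (m : ℤ_[p]) := by
  induction m with
  | zero => rw [pow_zero, Nat.cast_zero, translate_zero]; rfl
  | succ m ih => rw [pow_succ, ih, Nat.cast_succ, translate_add]; rfl

/-- **`τ₁ - 1` is locally nilpotent**: a function of level `n` with `p^k`-torsion values is killed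
by `(τ₁ - 1)^{k·pⁿ}` (`τ₁^{pⁿ} = τ_{pⁿ}` fixes it; `IwasawaDual.pow_mul_prime_pow_apply_eq_zero`).
This is "every element … is killed by `Tⁿ` for some `n`" (Greenberg) for `T ⊗ Λ^*`.
[cite: GreenbergLNM1716, §1 (discrete Λ-modules, after Conj. 1.3)] -/
theorem shiftSubOne_locNil : LocNil.IsLocNil (shiftSubOne : BigRepModule 𝒪 p A →ₗ[𝒪] _) := by
  intro Φ
  obtain ⟨n, hn⟩ := Φ.exists_level
  obtain ⟨k, hk⟩ := Φ.exists_torsion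
  refine ⟨k * p ^ n, ?_⟩
  set φ : AddMonoid.End (BigRepModule 𝒪 p A) :=
    (translate 1 : BigRepModule 𝒪 p A →ₗ[𝒪] _).toAddMonoidHom with hφdef
  have hφL : ∀ Ψ, φ Ψ = translate 1 Ψ := fun Ψ ↦ rfl
  have hφ : (φ ^ p ^ n) Φ = Φ := by
    rw [addMonoidEnd_pow_apply_eq φ _ hφL, translate_one_pow]
    exact translate_eq_self_of_mem hn (by rw [Nat.cast_pow]; exact Ideal.mem_span_singleton_self _)
  have hs : p ^ k • Φ = 0 := by
    ext x
    rw [nsmul_apply, zero_apply]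
    exact hk x
  have key := IwasawaDual.pow_mul_prime_pow_apply_eq_zero (Fact.out : p.Prime) φ n hφ hs
  have hsub : ∀ Ψ, (φ - 1) Ψ = shiftSubOne Ψ := fun Ψ ↦ rfl
  rw [addMonoidEnd_pow_apply_eq (φ - 1) shiftSubOne hsub] at key
  exact key

/-- The `PowerSeries 𝒪`-MODULE STRUCTURE on the big module: `T` acts as `τ₁ - 1`, constants as
scalars (`LocNil.IsLocNil.module` for `shiftSubOne`).
[cite: Castella2018, §2.1–2.2 (Λ-module 𝒜, 1 + T ↦ γ)] -/
instance instModulePowerSeries : Module (PowerSeries 𝒪) (BigRepModule 𝒪 p A) :=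
  (shiftSubOne_locNil (𝒪 := 𝒪) (p := p) (A := A)).module

/-- The `𝒪⟦T⟧`-action is the finite-sum action through `T ↦ τ₁ - 1` (`LocNil.IsLocNil.smulFun`;
compute with `LocNil.IsLocNil.smulFun_apply`). [cite: Castella2018, §2.2 (ℤ_p[[T]] = Λ via 1 + T ↦ γ)] -/
theorem powerSeries_smul_def (f : PowerSeries 𝒪) (Φ : BigRepModule 𝒪 p A) :
    f • Φ = (shiftSubOne_locNil (𝒪 := 𝒪) (p := p) (A := A)).smulFun f Φ := rfl

/-- **`T` acts as `τ₁ - 1`**: `(T • Φ)(x) = Φ(x + 1) - Φ(x)`.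
[cite: Castella2018, §2.2 (1 + T ↦ γ)] -/
theorem X_smul (Φ : BigRepModule 𝒪 p A) : (PowerSeries.X : PowerSeries 𝒪) • Φ = shiftSubOne Φ := by
  rw [powerSeries_smul_def, LocNil.IsLocNil.smulFun_X]

/-- `(T • Φ)(x) = Φ(x + 1) - Φ(x)` (`T = γ - 1` on `Λ^*`). [cite: Castella2018, §2.2 (ℤ_p[[T]] = Λ via 1 + T ↦ γ)] -/
@[simp] theorem X_smul_apply (Φ : BigRepModule 𝒪 p A) (x : ℤ_[p]) :
    ((PowerSeries.X : PowerSeries 𝒪) • Φ) x = Φ (x + 1) - Φ x := by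
  rw [X_smul, shiftSubOne_apply]

/-- Constants `c ∈ 𝒪 ⊆ 𝒪⟦T⟧ = Λ_𝒪` act as the `𝒪`-scalars: `C c • Φ = c • Φ`. [cite: Castella2018, §2.2 (ℤ_p[[T]] = Λ via 1 + T ↦ γ)] -/
@[simp] theorem C_smul (c : 𝒪) (Φ : BigRepModule 𝒪 p A) : (PowerSeries.C c) • Φ = c • Φ := by
  rw [powerSeries_smul_def, LocNil.IsLocNil.smulFun_C]

/-- The `𝒪`- and `𝒪⟦T⟧`-structures are compatible (`𝒪 → 𝒪⟦T⟧ = Λ_𝒪`). [cite: Castella2018, §2.2 (ℤ_p[[T]] = Λ via 1 + T ↦ γ)] -/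
instance instIsScalarTower : IsScalarTower 𝒪 (PowerSeries 𝒪) (BigRepModule 𝒪 p A) :=
  ⟨fun c f Φ ↦ by
    rw [powerSeries_smul_def, powerSeries_smul_def, LocNil.IsLocNil.smulFun_smul_left]⟩

/-- Translations (the action of `Γ ⊆ Λ^×` on `Λ^*`) are `Λ`-linear (`Λ` is commutative: they
commute with `τ₁ - 1`). [cite: Castella2018, §2.2 (ℤ_p[[T]] = Λ via 1 + T ↦ γ)] -/
theorem translate_powerSeries_smul (c : ℤ_[p]) (f : PowerSeries 𝒪) (Φ : BigRepModule 𝒪 p A) :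
    translate c (f • Φ) = f • translate c Φ := by
  rw [powerSeries_smul_def, powerSeries_smul_def]
  refine LocNil.IsLocNil.map_smulFun _ _ (translate c) (fun Ψ ↦ ?_) f Φ
  ext x
  rw [translate_apply, shiftSubOne_apply, shiftSubOne_apply, translate_apply, translate_apply,
    add_right_comm]

/-- `ContinuousSMul (PowerSeries 𝒪) M` for the DISCRETE topology on `𝒪⟦T⟧` (both factors discrete).
The product-topology version also holds (annihilators are open) but is not needed by the consumer,
which quantifies over the topology of `PowerSeries 𝒪`. [cite: Skinner2016PacificMC, §2.3 (Λ_𝒪^* is a discrete Λ_𝒪-module; 𝓜 = T ⊗ Λ_𝒪^*)] -/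
instance instContinuousSMulOfDiscrete [TopologicalSpace (PowerSeries 𝒪)]
    [DiscreteTopology (PowerSeries 𝒪)] : ContinuousSMul (PowerSeries 𝒪) (BigRepModule 𝒪 p A) :=
  ⟨continuous_of_discreteTopology⟩

end BigRepModule

end Functions

/-! ## Part 3. The `G`-action `ρ ⊗ Ψ⁻¹` and its continuity -/

section Action

variable {𝒪 : Type*} [CommRing 𝒪] [TopologicalSpace 𝒪] {p : ℕ} [Fact p.Prime]
  {A : Type*} [AddCommGroup A] [Module 𝒪 A] [TopologicalSpace A]
variable {G : Type*} [Group G] [TopologicalSpace G]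

open Literature.NumberTheory.GaloisRepresentations BigRepModule

/-- The action of `g` on smooth functions: `(g · Φ)(x) = ρ(g)(Φ(x - κ g))` — `ρ ⊗ Ψ⁻¹` in the
co-induced model — as an `𝒪`-linear map. [cite: Castella2018, §2.1 (G_K-action ρ ⊗ Ψ^{-1} on 𝒜)] -/
def bigRepAux (κ : G →ₜ* Multiplicative ℤ_[p]) (ρ : ContinuousRep G 𝒪 A) (g : G) :
    BigRepModule 𝒪 p A →ₗ[𝒪] BigRepModule 𝒪 p A where
  toFun Φ := mk (fun x ↦ ρ g (Φ (x - (κ g).toAdd))) (by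
    obtain ⟨n, hn⟩ := Φ.exists_level
    obtain ⟨k, hk⟩ := Φ.exists_torsion
    refine ⟨⟨n, fun x y hxy ↦ congrArg (ρ g) (hn _ _ (by simpa using hxy))⟩, ⟨k, fun x ↦ ?_⟩⟩
    rw [← map_nsmul, hk, map_zero])
  map_add' Φ Ψ := by
    ext x
    simp only [mk_apply, BigRepModule.add_apply, map_add]
  map_smul' c Φ := by
    ext x
    simp only [mk_apply, BigRepModule.smul_apply, RingHom.id_apply, map_smul]

/-- Unfolding the action: `(g · Φ)(x) = ρ(g)(Φ(x - κ g))` (`ρ ⊗ Ψ^{-1}`). [cite: Castella2018, §2.1 (𝒜 := T ⊗ Λ^*, G_K-action ρ ⊗ Ψ^{-1})] -/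
@[simp] theorem bigRepAux_apply (κ : G →ₜ* Multiplicative ℤ_[p]) (ρ : ContinuousRep G 𝒪 A) (g : G)
    (Φ : BigRepModule 𝒪 p A) (x : ℤ_[p]) :
    bigRepAux κ ρ g Φ x = ρ g (Φ (x - (κ g).toAdd)) := rfl

/-- `ρ ⊗ Ψ^{-1}` is a representation: `1` acts trivially. [cite: Castella2018, §2.1 (𝒜 := T ⊗ Λ^*, G_K-action ρ ⊗ Ψ^{-1})] -/
theorem bigRepAux_one (κ : G →ₜ* Multiplicative ℤ_[p]) (ρ : ContinuousRep G 𝒪 A) :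
    bigRepAux (p := p) κ ρ 1 = LinearMap.id := by
  ext Φ x
  rw [bigRepAux_apply, map_one, map_one, toAdd_one, sub_zero, Module.End.one_apply,
    LinearMap.id_apply]

/-- `ρ ⊗ Ψ^{-1}` is a representation: `(gh) · Φ = g · (h · Φ)`. [cite: Castella2018, §2.1 (𝒜 := T ⊗ Λ^*, G_K-action ρ ⊗ Ψ^{-1})] -/
theorem bigRepAux_mul (κ : G →ₜ* Multiplicative ℤ_[p]) (ρ : ContinuousRep G 𝒪 A) (g h : G) :
    bigRepAux (p := p) κ ρ (g * h) = bigRepAux κ ρ g ∘ₗ bigRepAux κ ρ h := by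
  ext Φ x
  simp only [bigRepAux_apply, map_mul, toAdd_mul, LinearMap.coe_comp, Function.comp_apply,
    Module.End.mul_apply, sub_add_eq_sub_sub]

/-- The `G`-action `ρ ⊗ Ψ^{-1}` on the `Λ`-MODULE `𝒜` is `Λ`-linear (translations commute;
`ρ g` is additive). [cite: Castella2018, §2.1 (𝒜 := T ⊗ Λ^*, G_K-action ρ ⊗ Ψ^{-1})] -/
theorem bigRepAux_powerSeries_smul (κ : G →ₜ* Multiplicative ℤ_[p]) (ρ : ContinuousRep G 𝒪 A)
    (g : G) (f : PowerSeries 𝒪) (Φ : BigRepModule 𝒪 p A) :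
    bigRepAux κ ρ g (f • Φ) = f • bigRepAux κ ρ g Φ := by
  rw [powerSeries_smul_def, powerSeries_smul_def]
  refine LocNil.IsLocNil.map_smulFun _ _ (bigRepAux κ ρ g) (fun Ψ ↦ ?_) f Φ
  ext x
  rw [bigRepAux_apply, shiftSubOne_apply, shiftSubOne_apply, bigRepAux_apply, bigRepAux_apply,
    map_sub, sub_add_eq_add_sub]

variable [DiscreteTopology A] [ContinuousMul G]

/-- **The stabiliser of a smooth function is open**: it contains the open neighbourhood
`κ⁻¹(pⁿℤ_p) ∩ ⋂_{r<pⁿ} Stab_ρ(Φ(r))` of `1` (`κ` continuous, `pⁿℤ_p` open, the `ρ`-stabilisers of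
the finitely many values open because `A` is discrete) and is closed under multiplication — i.e.
`G` acts continuously on the DISCRETE module `T ⊗ Λ^*` ("a discrete `Λ_𝒪`-module" with
`G`-action `ρ ⊗ Ψ^{-1}`). [cite: Skinner2016PacificMC, §2.3 (Λ_𝒪^* is a discrete Λ_𝒪-module; 𝓜 = T ⊗ Λ_𝒪^*)]
[cite: Castella2018, §2.1 (𝒜 := T ⊗ Λ^*, G_K-action ρ ⊗ Ψ^{-1})] -/
theorem bigRepAux_isOpen_stabilizer (κ : G →ₜ* Multiplicative ℤ_[p]) (ρ : ContinuousRep G 𝒪 A)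
    (Φ : BigRepModule 𝒪 p A) : IsOpen {g : G | bigRepAux κ ρ g Φ = Φ} := by
  obtain ⟨n, hn⟩ := Φ.exists_level
  obtain ⟨U, hU⟩ : ∃ U : Set G, U = {g : G | (κ g).toAdd ∈ Ideal.span {(p : ℤ_[p]) ^ n}} ∩
      ⋂ r ∈ Finset.range (p ^ n), {g : G | ρ g (Φ (r : ℤ_[p])) = Φ (r : ℤ_[p])} := ⟨_, rfl⟩
  -- `U` is open
  have hIopen : IsOpen (Ideal.span {(p : ℤ_[p]) ^ n} : Set ℤ_[p]) := by
    have hball : (Ideal.span {(p : ℤ_[p]) ^ n} : Set ℤ_[p]) =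
        Metric.closedBall (0 : ℤ_[p]) ((p : ℝ) ^ (-n : ℤ)) := by
      ext x
      rw [SetLike.mem_coe, Metric.mem_closedBall, dist_zero_right,
        PadicInt.norm_le_pow_iff_mem_span_pow]
    rw [hball]
    refine IsUltrametricDist.isOpen_closedBall _ (zpow_ne_zero _ ?_)
    exact_mod_cast (Fact.out : p.Prime).ne_zero
  have hUopen : IsOpen U := by
    rw [hU]
    refine (hIopen.preimage (continuous_toAdd.comp (map_continuous κ))).inter
      (isOpen_biInter_finset fun r _ ↦ ?_)
    exact (isOpen_discrete {Φ (r : ℤ_[p])}).preimage (ρ.continuous_apply_left (Φ (r : ℤ_[p])))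
  -- `U ⊆ Stab(Φ)`
  have hUsub : U ⊆ {g : G | bigRepAux κ ρ g Φ = Φ} := by
    intro g hg
    rw [hU, Set.mem_inter_iff, Set.mem_setOf_eq, Set.mem_iInter₂] at hg
    obtain ⟨hgκ, hgst⟩ := hg
    ext x
    rw [bigRepAux_apply]
    have h1 : Φ (x - (κ g).toAdd) = Φ x := hn _ _ (by
      rw [sub_sub_cancel_left]
      exact neg_mem hgκ)
    have h2 : Φ x = Φ ((x.appr n : ℕ) : ℤ_[p]) := hn _ _ (PadicInt.appr_spec n x)
    rw [h1, h2]
    exact hgst (x.appr n) (Finset.mem_range.mpr (PadicInt.appr_lt x n))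
  -- `1 ∈ U`
  have h1U : (1 : G) ∈ U := by
    rw [hU, Set.mem_inter_iff, Set.mem_setOf_eq, Set.mem_iInter₂, map_one, toAdd_one]
    exact ⟨Ideal.zero_mem _, fun r _ ↦ by rw [Set.mem_setOf_eq, map_one, Module.End.one_apply]⟩
  -- translate: every `g₀ ∈ Stab(Φ)` has the open neighbourhood `g₀ U ⊆ Stab(Φ)`
  rw [isOpen_iff_forall_mem_open]
  intro g₀ hg₀
  refine ⟨(fun g ↦ g₀⁻¹ * g) ⁻¹' U, fun g hg ↦ ?_, hUopen.preimage (continuous_const.mul continuous_id), ?_⟩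
  · have hg' : bigRepAux κ ρ (g₀⁻¹ * g) Φ = Φ := hUsub hg
    rw [Set.mem_setOf_eq] at hg₀ ⊢
    rw [← mul_inv_cancel_left g₀ g, bigRepAux_mul, LinearMap.comp_apply, hg', hg₀]
  · rw [Set.mem_preimage, inv_mul_cancel]
    exact h1U

/-- **The big representation `T ⊗_𝒪 Λ_𝒪^*(Ψ⁻¹)` (co-induced model)** attached to a continuous
`κ : G →ₜ* ℤ_p` and a discrete `𝒪`-linear continuous representation `ρ` of `G` on `A`: the
`PowerSeries 𝒪`-linear, jointly continuous representation of `G` on the discrete module of smooth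
`p`-primary functions `ℤ_p → A`, `(g · Φ)(x) = ρ(g)(Φ(x - κ g))`, `(T · Φ)(x) = Φ(x+1) - Φ(x)`.
For `G = Γ_K`, `κ` the anticyclotomic `ℤ_p`-extension and `A = E[p^∞] ⊗ 𝒪` resp. `A_{g_m}` this
is Castella's `𝒜 = T ⊗ Λ^*` resp. the erratum's `M_g = T_g ⊗_𝒪 Λ_𝒪^*`, `G_K` acting by `ρ ⊗ Ψ⁻¹`.
[cite: Castella2018, §2.1 (𝒜 := T ⊗_{ℤ_p} Λ^*, action ρ_{E,p} ⊗ Ψ^{-1}) and §2.2 (1 + T ↦ γ)]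
[cite: Castella2018Erratum, §2 (M_g := T_g ⊗_𝒪 Λ_𝒪^*, G_K acts on Λ_𝒪^* via Ψ^{-1})]
[cite: SkinnerUrban2014, Prop. 3.2.3 (the co-induced model, Shapiro)] -/
def bigRep (κ : G →ₜ* Multiplicative ℤ_[p]) (ρ : ContinuousRep G 𝒪 A)
    [TopologicalSpace (PowerSeries 𝒪)] :
    ContinuousRep G (PowerSeries 𝒪) (BigRepModule 𝒪 p A) where
  toRepresentation :=
    { toFun := fun g ↦
        { toFun := bigRepAux κ ρ g
          map_add' := map_add (bigRepAux κ ρ g)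
          map_smul' := fun f Φ ↦ bigRepAux_powerSeries_smul κ ρ g f Φ }
      map_one' := LinearMap.ext fun Φ ↦ by
        change bigRepAux κ ρ 1 Φ = Φ
        rw [bigRepAux_one, LinearMap.id_apply]
      map_mul' := fun g h ↦ LinearMap.ext fun Φ ↦ by
        change bigRepAux κ ρ (g * h) Φ = bigRepAux κ ρ g (bigRepAux κ ρ h Φ)
        rw [bigRepAux_mul, LinearMap.comp_apply] }
  continuous_smul := by
    -- `M` is discrete: continuity = local constancy, from the open stabilisers
    refine ((IsLocallyConstant.iff_eventually_eq _).mpr ?_).continuous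
    rintro ⟨g₀, Φ⟩
    have hV : IsOpen (((fun g ↦ g₀⁻¹ * g) ⁻¹' {g : G | bigRepAux κ ρ g Φ = Φ}) ×ˢ
        ({Φ} : Set (BigRepModule 𝒪 p A))) :=
      ((bigRepAux_isOpen_stabilizer κ ρ Φ).preimage (continuous_const.mul continuous_id)).prod
        (isOpen_discrete _)
    have hmem : (g₀, Φ) ∈ ((fun g ↦ g₀⁻¹ * g) ⁻¹' {g : G | bigRepAux κ ρ g Φ = Φ}) ×ˢ
        ({Φ} : Set (BigRepModule 𝒪 p A)) := by
      refine ⟨?_, rfl⟩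
      rw [Set.mem_preimage, Set.mem_setOf_eq, inv_mul_cancel, bigRepAux_one, LinearMap.id_apply]
    filter_upwards [hV.mem_nhds hmem]
    rintro ⟨g, Ψ⟩ ⟨hg, hΨ⟩
    rw [Set.mem_singleton_iff] at hΨ
    subst hΨ
    rw [Set.mem_preimage, Set.mem_setOf_eq] at hg
    change bigRepAux κ ρ g Ψ = bigRepAux κ ρ g₀ Ψ
    rw [← mul_inv_cancel_left g₀ g, bigRepAux_mul, LinearMap.comp_apply, hg]

/-- Unfolding `bigRep`: `(g · Φ)(x) = ρ(g)(Φ(x - κ g))`.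
[cite: Castella2018, §2.1 (action ρ ⊗ Ψ^{-1})] -/
@[simp] theorem bigRep_apply_apply (κ : G →ₜ* Multiplicative ℤ_[p]) (ρ : ContinuousRep G 𝒪 A)
    [TopologicalSpace (PowerSeries 𝒪)] (g : G) (Φ : BigRepModule 𝒪 p A) (x : ℤ_[p]) :
    bigRep κ ρ g Φ x = ρ g (Φ (x - (κ g).toAdd)) := rfl

/-- `bigRep κ ρ g` is the `𝒪`-linear map `bigRepAux κ ρ g` (same underlying function). [cite: Castella2018, §2.1 (𝒜 := T ⊗ Λ^*, G_K-action ρ ⊗ Ψ^{-1})] -/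
theorem bigRep_apply_eq (κ : G →ₜ* Multiplicative ℤ_[p]) (ρ : ContinuousRep G 𝒪 A)
    [TopologicalSpace (PowerSeries 𝒪)] (g : G) (Φ : BigRepModule 𝒪 p A) :
    bigRep κ ρ g Φ = bigRepAux κ ρ g Φ := rfl

/-- The stabilisers of `bigRep` are open (continuity of the `G`-action on the discrete module
`T ⊗ Λ^*`, pointwise form). [cite: Skinner2016PacificMC, §2.3 (Λ_𝒪^* is a discrete Λ_𝒪-module; 𝓜 = T ⊗ Λ_𝒪^*)] -/
theorem bigRep_isOpen_stabilizer (κ : G →ₜ* Multiplicative ℤ_[p]) (ρ : ContinuousRep G 𝒪 A)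
    [TopologicalSpace (PowerSeries 𝒪)] (Φ : BigRepModule 𝒪 p A) :
    IsOpen {g : G | bigRep κ ρ g Φ = Φ} :=
  bigRepAux_isOpen_stabilizer κ ρ Φ

/-- Restriction of `bigRep` along `φ : H →ₜ* G` (e.g. a decomposition group `G_{K_𝔭̄} → G_K`, the
local map `ψ_𝔭̄ : G_{K_𝔭̄} → G_K` of Castella's strict condition `L_𝔭̄ = ker`, display in the proof
of Thm. 2.6) is `bigRep` of the restricted data `(κ ∘ φ, ρ|_H)`.
[cite: Castella2018, §2.1 (𝒜 := T ⊗ Λ^*, G_K-action ρ ⊗ Ψ^{-1})] [cite: Castella2018, §2.1, proof of Thm. 2.6 (local conditions at 𝔭, 𝔭̄)] -/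
theorem bigRep_restrict {H : Type*} [Group H] [TopologicalSpace H] [ContinuousMul H]
    (κ : G →ₜ* Multiplicative ℤ_[p]) (ρ : ContinuousRep G 𝒪 A) [TopologicalSpace (PowerSeries 𝒪)]
    (φ : H →ₜ* G) : (bigRep κ ρ).restrict φ = bigRep (p := p) (κ.comp φ) (ρ.restrict φ) :=
  ContinuousRep.ext fun _ ↦ rfl

end Action

/-! ## Part 4. The anticyclotomic specialisation -/

section Anticyclotomic

open Literature.NumberTheory.GaloisRepresentations

universe u

variable {K : Type u} [Field K] {p : ℕ} [Fact p.Prime]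
variable {𝒪 : Type*} [CommRing 𝒪] [TopologicalSpace 𝒪] {A : Type*} [AddCommGroup A] [Module 𝒪 A]
  [TopologicalSpace A] [DiscreteTopology A]

/-- **`M = T ⊗_𝒪 Λ_𝒪^*(Ψ⁻¹)` over the `ℤ_p`-extension `κ` of `K`** (D1+D2 of SPEC-19270-RoadFF):
`bigRep` for `G = Γ_K = Field.absoluteGaloisGroup K` and `κ : ZpExtension K p` (for the erratum
road: `K` imaginary quadratic, `κ` anticyclotomic, `A = E[p^∞] ⊗ 𝒪` or `A_{g_m}`; `T` acts as
`τ₁ - 1`, the topological generator being normalised by `κ γ = 1`, `ZpExtension.IsTopGenerator`).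
[cite: Castella2018Erratum, §2 (M_g, action via Ψ^{-1})] [cite: Castella2018, §2.1–2.2] -/
abbrev AnticyclotomicBigGaloisRep [TopologicalSpace (PowerSeries 𝒪)] (κ : ZpExtension K p)
    (ρ : ContinuousRep (Field.absoluteGaloisGroup K) 𝒪 A) :
    ContinuousRep (Field.absoluteGaloisGroup K) (PowerSeries 𝒪) (BigRepModule 𝒪 p A) :=
  bigRep κ.toContinuousMonoidHom ρ

/-- A topological generator `γ` (`κ γ = 1`) acts on `M` by `(γ · Φ)(x) = ρ(γ)(Φ(x - 1))`
(unfolding; with `bigRep_apply_apply` and `BigRepModule.X_smul_apply` this pins down the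
normalisation "`1 + T ↦ γ` on `Λ`, acting on `Λ^*` through `Ψ⁻¹`").
[cite: Castella2018, §2.2 (1 + T ↦ γ)] -/
theorem AnticyclotomicBigGaloisRep_apply_of_isTopGenerator [TopologicalSpace (PowerSeries 𝒪)]
    (κ : ZpExtension K p) (ρ : ContinuousRep (Field.absoluteGaloisGroup K) 𝒪 A)
    {γ : Field.absoluteGaloisGroup K} (hγ : κ.IsTopGenerator γ) (Φ : BigRepModule 𝒪 p A)
    (x : ℤ_[p]) : AnticyclotomicBigGaloisRep κ ρ γ Φ x = ρ γ (Φ (x - 1)) := by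
  have h1 : (κ γ).toAdd = (1 : ℤ_[p]) := by
    rw [show κ γ = Multiplicative.ofAdd 1 from hγ, toAdd_ofAdd]
  change bigRep κ.toContinuousMonoidHom ρ γ Φ x = _
  rw [bigRep_apply_apply, ZpExtension.coe_toContinuousMonoidHom, h1]

end Anticyclotomic

/-! ## Part 5. Functoriality in the coefficients `A` (appended 2026-08-27, same seat)

The construction `A ↦ A ⊗ "Λ^*"` (here: `A ↦ BigRepModule 𝒪 p A`) is functorial in the `𝒪`-module `A`
by post-composition, compatibly with the `𝒪⟦T⟧`-structure and with the `G`-actions along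
`G`-equivariant maps. This is how the erratum transports the congruence
*"(b) a `G_ℚ`-stable lattice `T_{g_m} ⊂ V_{g_m}` and an isomorphism `T_{g_m}/p^m T_{g_m} ≃ T/p^m T` as
`𝒪[G_ℚ]`-modules"* (p. 4) to `M_{g_m}[p^m] ≃ M_f[p^m]` — the input `θ_m` of the kernel transfer
`X11b.TorsionControl.powerSeries_charIdeal_le_span_of_selmer_congruences`. -/

section Functoriality

variable {𝒪 : Type*} [CommRing 𝒪] {p : ℕ} [Fact p.Prime] {A : Type*} [AddCommGroup A] [Module 𝒪 A]
  {A' : Type*} [AddCommGroup A'] [Module 𝒪 A'] {A'' : Type*} [AddCommGroup A''] [Module 𝒪 A'']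

namespace BigRepModule

/-- **Functoriality of `A ↦ A ⊗ Λ^*` in `A`**: post-composition `Φ ↦ L ∘ Φ` with an `𝒪`-linear map
`L : A → A'` (levels and `p`-power torsion are preserved), an `𝒪`-linear map
`BigRepModule 𝒪 p A → BigRepModule 𝒪 p A'`. [cite: Castella2018Erratum, §2 p. 4 ((b): T_{g_m}/p^m T_{g_m} ≃ T/p^m T as 𝒪[G_ℚ]-modules, transported to M_g = T_g ⊗_𝒪 Λ_𝒪^*)] -/
def mapRange (L : A →ₗ[𝒪] A') : BigRepModule 𝒪 p A →ₗ[𝒪] BigRepModule 𝒪 p A' where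
  toFun Φ := mk (fun x ↦ L (Φ x)) (by
    obtain ⟨n, hn⟩ := Φ.exists_level
    obtain ⟨k, hk⟩ := Φ.exists_torsion
    exact ⟨⟨n, fun x y hxy ↦ congrArg L (hn x y hxy)⟩, ⟨k, fun x ↦ by rw [← map_nsmul, hk, map_zero]⟩⟩)
  map_add' Φ Ψ := by
    ext x
    simp only [mk_apply, BigRepModule.add_apply, map_add]
  map_smul' c Φ := by
    ext x
    simp only [mk_apply, BigRepModule.smul_apply, RingHom.id_apply, map_smul]

/-- Unfolding `mapRange`: `(L_* Φ)(x) = L (Φ x)`. [cite: Castella2018Erratum, §2 p. 4 ((b): T_{g_m}/p^m T_{g_m} ≃ T/p^m T as 𝒪[G_ℚ]-modules, transported to M_g = T_g ⊗_𝒪 Λ_𝒪^*)] -/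
@[simp] theorem mapRange_apply (L : A →ₗ[𝒪] A') (Φ : BigRepModule 𝒪 p A) (x : ℤ_[p]) :
    mapRange L Φ x = L (Φ x) := rfl

/-- Functoriality: the identity acts as the identity. [cite: Castella2018Erratum, §2 p. 4 ((b): T_{g_m}/p^m T_{g_m} ≃ T/p^m T as 𝒪[G_ℚ]-modules, transported to M_g = T_g ⊗_𝒪 Λ_𝒪^*)] -/
theorem mapRange_id :
    mapRange (LinearMap.id : A →ₗ[𝒪] A) = (LinearMap.id : BigRepModule 𝒪 p A →ₗ[𝒪] _) := by
  ext Φ x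
  rfl

/-- Functoriality: `(L' ∘ L)_* = L'_* ∘ L_*`. [cite: Castella2018Erratum, §2 p. 4 ((b): T_{g_m}/p^m T_{g_m} ≃ T/p^m T as 𝒪[G_ℚ]-modules, transported to M_g = T_g ⊗_𝒪 Λ_𝒪^*)] -/
theorem mapRange_comp (L : A →ₗ[𝒪] A') (L' : A' →ₗ[𝒪] A'') :
    mapRange (p := p) (L' ∘ₗ L) = mapRange L' ∘ₗ mapRange L := by
  ext Φ x
  rfl

/-- `L_*` commutes with the translations `τ_c` (it acts on values, `τ_c` on the variable).
[cite: Castella2018Erratum, §2 p. 4 ((b): T_{g_m}/p^m T_{g_m} ≃ T/p^m T as 𝒪[G_ℚ]-modules, transported to M_g = T_g ⊗_𝒪 Λ_𝒪^*)] -/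
theorem mapRange_translate (L : A →ₗ[𝒪] A') (c : ℤ_[p]) (Φ : BigRepModule 𝒪 p A) :
    mapRange L (translate c Φ) = translate c (mapRange L Φ) := by
  ext x
  rfl

/-- `L_*` is `𝒪⟦T⟧`-LINEAR (it commutes with `τ₁ - 1`, through which `T` acts). [cite: Castella2018Erratum, §2 p. 4 ((b): T_{g_m}/p^m T_{g_m} ≃ T/p^m T as 𝒪[G_ℚ]-modules, transported to M_g = T_g ⊗_𝒪 Λ_𝒪^*)] -/
theorem mapRange_powerSeries_smul (L : A →ₗ[𝒪] A') (f : PowerSeries 𝒪) (Φ : BigRepModule 𝒪 p A) :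
    mapRange L (f • Φ) = f • mapRange L Φ := by
  rw [powerSeries_smul_def, powerSeries_smul_def]
  refine LocNil.IsLocNil.map_smulFun _ _ (mapRange L) (fun Ψ ↦ ?_) f Φ
  ext x
  rw [mapRange_apply, shiftSubOne_apply, shiftSubOne_apply, mapRange_apply, mapRange_apply, map_sub]

/-- `L_*` as a `PowerSeries 𝒪`-linear map `BigRepModule 𝒪 p A →ₗ[𝒪⟦T⟧] BigRepModule 𝒪 p A'` (the map
underlying `M_f[p^m] ≃ M_{g_m}[p^m]` when `L` is the erratum's isomorphism (b) on `p^m`-torsion).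
[cite: Castella2018Erratum, §2 p. 4 ((b): T_{g_m}/p^m T_{g_m} ≃ T/p^m T as 𝒪[G_ℚ]-modules, transported to M_g = T_g ⊗_𝒪 Λ_𝒪^*)] -/
def mapRangeₗ (L : A →ₗ[𝒪] A') : BigRepModule 𝒪 p A →ₗ[PowerSeries 𝒪] BigRepModule 𝒪 p A' where
  toFun := mapRange L
  map_add' := map_add (mapRange L)
  map_smul' f Φ := mapRange_powerSeries_smul L f Φ

/-- Unfolding `mapRangeₗ`. [cite: Castella2018Erratum, §2 p. 4 ((b): T_{g_m}/p^m T_{g_m} ≃ T/p^m T as 𝒪[G_ℚ]-modules, transported to M_g = T_g ⊗_𝒪 Λ_𝒪^*)] -/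
@[simp] theorem mapRangeₗ_apply (L : A →ₗ[𝒪] A') (Φ : BigRepModule 𝒪 p A) :
    mapRangeₗ L Φ = mapRange L Φ := rfl

/-- `L_*` is injective when `L` is. [cite: Castella2018Erratum, §2 p. 4 ((b): T_{g_m}/p^m T_{g_m} ≃ T/p^m T as 𝒪[G_ℚ]-modules, transported to M_g = T_g ⊗_𝒪 Λ_𝒪^*)] -/
theorem mapRange_injective {L : A →ₗ[𝒪] A'} (hL : Function.Injective L) :
    Function.Injective (mapRange (p := p) L) := by
  intro Φ Ψ h
  ext x
  have hx := DFunLike.congr_fun h x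
  rw [mapRange_apply, mapRange_apply] at hx
  exact hL hx

/-- `L_*` is surjective when `L` is surjective WITH an `𝒪`-linear section (e.g. `L` an isomorphism):
then `Φ' = L_* (s ∘ Φ')`. [cite: Castella2018Erratum, §2 p. 4 ((b): T_{g_m}/p^m T_{g_m} ≃ T/p^m T as 𝒪[G_ℚ]-modules, transported to M_g = T_g ⊗_𝒪 Λ_𝒪^*)] -/
theorem mapRange_surjective_of_leftInverse {L : A →ₗ[𝒪] A'} {s : A' →ₗ[𝒪] A}
    (hs : Function.LeftInverse L s) : Function.Surjective (mapRange (p := p) L) := by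
  intro Φ'
  refine ⟨mapRange s Φ', ?_⟩
  ext x
  rw [mapRange_apply, mapRange_apply, hs]

/-- An `𝒪`-linear isomorphism `e : A ≃ A'` induces the `𝒪⟦T⟧`-linear isomorphism `e_*` (the shape of
`M_{g_m}[p^m] ≃ M_f[p^m]` obtained from (b)). [cite: Castella2018Erratum, §2 p. 4 ((b): T_{g_m}/p^m T_{g_m} ≃ T/p^m T as 𝒪[G_ℚ]-modules, transported to M_g = T_g ⊗_𝒪 Λ_𝒪^*)] -/
def mapRangeEquiv (e : A ≃ₗ[𝒪] A') : BigRepModule 𝒪 p A ≃ₗ[PowerSeries 𝒪] BigRepModule 𝒪 p A' where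
  toLinearMap := mapRangeₗ e.toLinearMap
  invFun := mapRange e.symm.toLinearMap
  left_inv Φ := by
    ext x
    change e.symm (e (Φ x)) = Φ x
    exact e.symm_apply_apply (Φ x)
  right_inv Φ' := by
    ext x
    change e (e.symm (Φ' x)) = Φ' x
    exact e.apply_symm_apply (Φ' x)

/-- Unfolding `mapRangeEquiv`. [cite: Castella2018Erratum, §2 p. 4 ((b): T_{g_m}/p^m T_{g_m} ≃ T/p^m T as 𝒪[G_ℚ]-modules, transported to M_g = T_g ⊗_𝒪 Λ_𝒪^*)] -/
@[simp] theorem mapRangeEquiv_apply (e : A ≃ₗ[𝒪] A') (Φ : BigRepModule 𝒪 p A) (x : ℤ_[p]) :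
    mapRangeEquiv e Φ x = e (Φ x) := rfl

end BigRepModule

open Literature.NumberTheory.GaloisRepresentations BigRepModule

variable [TopologicalSpace 𝒪] [TopologicalSpace A] [DiscreteTopology A] [TopologicalSpace A']
  [DiscreteTopology A'] {G : Type*} [Group G] [TopologicalSpace G] [ContinuousMul G]
  [TopologicalSpace (PowerSeries 𝒪)]

/-- **`G`-equivariance of `L_*`**: if `L` intertwines `ρ` and `ρ'` (`L ∘ ρ(g) = ρ'(g) ∘ L`, e.g. the
`𝒪[G_ℚ]`-isomorphism (b) of the erratum on `p^m`-torsion) then `L_*` intertwines the big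
representations `bigRep κ ρ` and `bigRep κ ρ'` (same `κ`): the transport of `A_{g_m}[ϖ^m] ≃ A_f[ϖ^m]`
to `M_{g_m}[ϖ^m] ≃ M_f[ϖ^m]` as `𝒪⟦T⟧[G_K]`-modules. [cite: Castella2018Erratum, §2 p. 4 ((b): T_{g_m}/p^m T_{g_m} ≃ T/p^m T as 𝒪[G_ℚ]-modules, transported to M_g = T_g ⊗_𝒪 Λ_𝒪^*)] -/
theorem mapRange_bigRep (κ : G →ₜ* Multiplicative ℤ_[p]) (ρ : ContinuousRep G 𝒪 A)
    (ρ' : ContinuousRep G 𝒪 A') (L : A →ₗ[𝒪] A') (hL : ∀ (g : G) (a : A), L (ρ g a) = ρ' g (L a))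
    (g : G) (Φ : BigRepModule 𝒪 p A) :
    mapRange L (bigRep κ ρ g Φ) = bigRep κ ρ' g (mapRange L Φ) := by
  ext x
  rw [mapRange_apply, bigRep_apply_apply, bigRep_apply_apply, mapRange_apply, hL]

/-- The same for an equivariant isomorphism `e`, in `LinearEquiv` form (`e_* ∘ ρ_M(g) = ρ_{M'}(g) ∘ e_*`).
[cite: Castella2018Erratum, §2 p. 4 ((b): T_{g_m}/p^m T_{g_m} ≃ T/p^m T as 𝒪[G_ℚ]-modules, transported to M_g = T_g ⊗_𝒪 Λ_𝒪^*)] -/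
theorem mapRangeEquiv_bigRep (κ : G →ₜ* Multiplicative ℤ_[p]) (ρ : ContinuousRep G 𝒪 A)
    (ρ' : ContinuousRep G 𝒪 A') (e : A ≃ₗ[𝒪] A') (he : ∀ (g : G) (a : A), e (ρ g a) = ρ' g (e a))
    (g : G) (Φ : BigRepModule 𝒪 p A) :
    mapRangeEquiv e (bigRep κ ρ g Φ) = bigRep κ ρ' g (mapRangeEquiv e Φ) := by
  ext x
  rw [mapRangeEquiv_apply, bigRep_apply_apply, bigRep_apply_apply, mapRangeEquiv_apply, he]

end Functoriality

end Literature.NumberTheory.EllipticCurves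

end
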